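import Literature.MathematicalPhysics.QuantumLattice.LieTrotter
import HarnessLib

/-!
# qDRIFT: the randomized product-formula error bound (Campbell 2019, App. B)

Topic `Literature/Computability/QuantumAlgorithms` (digital quantum simulation by product formulas;
sibling of `TrotterErrorFirstOrder.lean`).  Source: E. Campbell, *Random Compiler for Fast
Hamiltonian Simulation*, Phys. Rev. Lett. **123**, 070503 (2019) = arXiv:1811.08017 [Campbell2019],
main text eqs. (5)–(11) and Appendix B (B1)–(B13), held text `paper:arxiv-1811.08017` p0002–p0003,
p0006–p0007:

"`H = Σ_{j=1}^L h_j H_j` … each of which is Hermitian and normalised … `λ = Σ_j h_j` … The strength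
`τ_j` of each unitary is fixed to a constant `τ_j = τ := tλ/N` … The probability of choosing unitary
`e^{iτH_j}` is … `p_j = h_j/λ` … `𝓔(ρ) = Σ_j p_j e^{iτH_j} ρ e^{−iτH_j} = Σ_j (h_j/λ) e^{τ𝓛_j}` (5),(6),(B6)
… `𝓤_N = e^{t𝓛/N}` (B9) … `‖𝓛‖_◇ ≤ 2‖H‖ ≤ 2λ` (B3), `𝓛 = Σ_j h_j 𝓛_j` (B4), `‖𝓛_j‖_◇ ≤ 2‖H_j‖ ≤ 2`
(B5) … We see the first two terms of `𝓔` and `𝓤_N` will match whenever `τ = λt/N` …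
`‖𝓤_N − 𝓔‖_◇ ≤ Σ_{n≥2} tⁿ‖𝓛ⁿ‖_◇/(n! Nⁿ) + Σ_j (h_j/λ) Σ_{n≥2} λⁿtⁿ‖𝓛_jⁿ‖_◇/(n! Nⁿ)
≤ 2 Σ_{n≥2} (1/n!)(2λt/N)ⁿ` … for all positive `x` we have `Σ_{n≥2} xⁿ/n! ≤ (x²/2) eˣ` (B11) …
`d(𝓤_N, 𝓔) ≤ (2λ²t²/N²) e^{2λt/N}` (B12) … Since the diamond distance is subadditive under
composition we have that `d_◇(𝓤, 𝓔^N) ≤ N d(𝓤_N, 𝓔) = (2λ²t²/N) e^{2λt/N} ≈ 2λ²t²/N` (B13)"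
(the paper's diamond DISTANCE carries a factor `½`: `d = ½‖·‖_◇`).

Design.  Exactly as the tree's `TrotterErrorFirstOrder.lean` and `LieTrotter.lean`, the statement is
proved in an arbitrary complete normed real algebra `𝔸` with `‖1‖ = 1` (the printed instance is the
algebra of superoperators with the diamond norm; the Liouvillians `𝓛_j` are its elements `L j`, with
the printed normalisation `‖L j‖ ≤ 2` as a hypothesis).  The channel property "`𝓔`, `𝓤_N` are
contractions" that makes the diamond distance subadditive under composition enters the `N`-step
bound as the hypotheses `‖e^{τ L_j}‖ ≤ 1`, `‖𝓤_N‖ ≤ 1` (true for unitary channels).  Everything is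
stated in NORM form; halving gives the printed distance form.

## Contents (all proved, 0 named facts)

* `norm_exp_sub_one_sub_le_half` — the tail bound (B11) as a Taylor remainder:
  `‖exp a − 1 − a‖ ≤ (‖a‖²/2) e^{‖a‖}` (sharpening the tree's `LieTrotter.norm_exp_sub_one_sub_le` by
  the printed factor `½`) [cite: Campbell2019, App. B eq. (B11)].
* `step h L τ = Σ_j (h_j/λ) • exp(τ • L_j)` — the qDRIFT one-step channel (B6); `slice h L t N =
  exp((t/N) • Σ_j h_j • L_j)` — the exact slice `𝓤_N` (B9) with `𝓛 = Σ h_j 𝓛_j` (B4).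
* **`norm_slice_sub_step_le`** — (B10)/(B12) in norm form: for `h_j ≥ 0`, `λ = Σ h_j > 0`,
  `‖L_j‖ ≤ 2`, `t ≥ 0`, `N ≥ 1` and `τ = λt/N`:
  `‖𝓤_N − 𝓔‖ ≤ (2λt/N)² e^{2λt/N}` (`= 2 · (x²/2)eˣ`, `x = 2λt/N`; the printed
  `d(𝓤_N,𝓔) ≤ 2λ²t²/N² · e^{2λt/N}` is half of it).
* **`norm_exp_sub_step_pow_le`** — (B13) in norm form: under the contraction hypotheses,
  `‖e^{t𝓛} − 𝓔^N‖ ≤ N · (2λt/N)² e^{2λt/N} = (4λ²t²/N) e^{2λt/N}`, i.e. the printed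
  `d_◇(𝓤, 𝓔^N) ≤ (2λ²t²/N) e^{2λt/N}`; `slice_pow` (`𝓤_N^N = e^{t𝓛}`), `norm_step_le_one`.

Not formalised: the diamond norm itself and the identification of `‖𝓛_j‖_◇ ≤ 2‖H_j‖` (B3)/(B5)
(entered as hypotheses), the sampling pseudocode / i.i.d. average over gate lists (the channel `𝓔^N`
IS that average), and the gate-count comparisons of Table I / App. C.

(pub-qadeq lane context — CLAIMS E-64 (IBM ‘SqDRIFT’ sample-based Krylov diagonalization with qDRIFT
randomisation, 72–100 qubits; the row's note "the qDRIFT randomisation and sampling are NOT covered")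
and the chemistry-dynamics A-rows that cost time evolution by qDRIFT: the printed `N = ⌈2λ²t²/ε⌉`
gate count is now backed by a tree inequality with explicit constants.  HONEST FRAMING: instance-level
adjudication of specific advantage claims; no claim about BQP vs BPP or the summit — an inequality in
a Banach algebra, nothing about any device or molecule.)

## References
* [Campbell2019] E. Campbell, Random Compiler for Fast Hamiltonian Simulation, Phys. Rev. Lett. 123,
  070503 (2019), doi:10.1103/PhysRevLett.123.070503, arXiv:1811.08017 — eqs. (5)–(11), App. B.
* Tree: `Literature/MathematicalPhysics/QuantumLattice/LieTrotter.lean` (`norm_exp_le`,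
  `norm_expSeries_term_le`, `norm_pow_sub_pow_le'`), `TrotterErrorFirstOrder.lean` (the contraction-
  hypothesis design).
-/

namespace Literature.Computability.QuantumAlgorithms

namespace QDrift

open NormedSpace Finset Literature.MathematicalPhysics.QuantumLattice
open scoped Nat

section Remainder

variable {𝔸 : Type*} [NormedRing 𝔸] [NormOneClass 𝔸]
variable (𝕂 : Type*) [RCLike 𝕂] [NormedAlgebra 𝕂 𝔸] [CompleteSpace 𝔸]

include 𝕂 in
/-- **The exponential tail bound (B11)** as a second-order Taylor remainder in a Banach algebra with
`‖1‖ = 1`: `‖exp a − 1 − a‖ ≤ Σ_{n≥2} ‖a‖ⁿ/n! ≤ (‖a‖²/2) e^{‖a‖}` (termwise `‖a‖^{n+2}/(n+2)! ≤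
(‖a‖²/2)·‖a‖ⁿ/n!` since `(n+2)! ≥ 2·n!`). [cite: Campbell2019, App. B eq. (B11) ("for all positive x we have Σ_{n≥2} xⁿ/n! ≤ (x²/2)eˣ")] -/
theorem norm_exp_sub_one_sub_le_half (a : 𝔸) :
    ‖exp a - 1 - a‖ ≤ ‖a‖ ^ 2 / 2 * Real.exp ‖a‖ := by
  have h1 : HasSum (fun n => (n !⁻¹ : 𝕂) • a ^ n) (exp a) := exp_series_hasSum_exp' a
  have h1' : HasSum (fun n => ((n + 2) !⁻¹ : 𝕂) • a ^ (n + 2)) (exp a - 1 - a) := by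
    have h := (hasSum_nat_add_iff' 2).mpr h1
    simp only [Finset.sum_range_succ, Finset.sum_range_zero, zero_add, Nat.factorial_zero,
      Nat.cast_one, inv_one, one_smul, pow_zero, Nat.factorial_one, pow_one] at h
    rwa [sub_sub]
  have h2 : HasSum (fun n => ‖a‖ ^ 2 / 2 * (‖a‖ ^ n / n !)) (‖a‖ ^ 2 / 2 * Real.exp ‖a‖) := by
    rw [Real.exp_eq_exp_ℝ]
    exact (expSeries_div_hasSum_exp ‖a‖).mul_left _
  refine h1'.norm_le_of_bounded h2 fun n => ?_
  have hfac : (2 * n ! : ℝ) ≤ (n + 2) ! := by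
    have h : 2 * n ! ≤ (n + 2) ! := by
      rw [Nat.factorial_succ, Nat.factorial_succ]
      calc 2 * n ! ≤ (n + 1 + 1) * (1 * n !) := by nlinarith [Nat.factorial_pos n]
        _ ≤ (n + 1 + 1) * ((n + 1) * n !) := by
            apply Nat.mul_le_mul_left; exact Nat.mul_le_mul_right _ (Nat.succ_le_succ (Nat.zero_le n))
    exact_mod_cast h
  calc ‖((n + 2) !⁻¹ : 𝕂) • a ^ (n + 2)‖
      ≤ ‖a‖ ^ (n + 2) / (n + 2) ! := by exact_mod_cast norm_expSeries_term_le 𝕂 a (n + 2)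
    _ ≤ ‖a‖ ^ (n + 2) / (2 * n !) :=
        div_le_div_of_nonneg_left (by positivity) (by positivity) hfac
    _ = ‖a‖ ^ 2 / 2 * (‖a‖ ^ n / n !) := by ring

omit [NormOneClass 𝔸] [NormedAlgebra 𝕂 𝔸] [CompleteSpace 𝔸] in
/-- The majorant `r ↦ (r²/2) eʳ` is monotone on `r ≥ 0`. [cite: Campbell2019, App. B (B11)–(B12) (the bound is applied at the common upper bound x = 2λt/N)] -/
theorem sq_half_mul_exp_mono {r s : ℝ} (hr : 0 ≤ r) (hrs : r ≤ s) :
    r ^ 2 / 2 * Real.exp r ≤ s ^ 2 / 2 * Real.exp s := by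
  have h1 : r ^ 2 ≤ s ^ 2 := pow_le_pow_left₀ hr hrs 2
  have h2 : Real.exp r ≤ Real.exp s := Real.exp_le_exp.mpr hrs
  have h3 : 0 ≤ Real.exp r := (Real.exp_pos r).le
  nlinarith [sq_nonneg s]

include 𝕂 in
/-- Remainder bound at a common radius: `‖a‖ ≤ x ⟹ ‖exp a − 1 − a‖ ≤ (x²/2)eˣ`.
[cite: Campbell2019, App. B (B10)–(B12)] -/
theorem norm_exp_sub_one_sub_le_of_norm_le {a : 𝔸} {x : ℝ} (hax : ‖a‖ ≤ x) :
    ‖exp a - 1 - a‖ ≤ x ^ 2 / 2 * Real.exp x :=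
  (norm_exp_sub_one_sub_le_half 𝕂 a).trans (sq_half_mul_exp_mono (norm_nonneg a) hax)

end Remainder

section Channel

variable {𝔸 : Type*} [NormedRing 𝔸] [NormOneClass 𝔸] [NormedAlgebra ℝ 𝔸] [CompleteSpace 𝔸]
variable {ι : Type*} [Fintype ι]

/-- **The qDRIFT one-step channel** `𝓔 = Σ_j (h_j/λ) e^{τ𝓛_j}`, `λ = Σ_j h_j` (eqs. (5)–(6), (B6)).
[cite: Campbell2019, eq. (6) and App. B eq. (B6)] -/
noncomputable def step (h : ι → ℝ) (L : ι → 𝔸) (τ : ℝ) : 𝔸 :=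
  ∑ j, (h j / ∑ i, h i) • exp (τ • L j)

/-- **The exact slice** `𝓤_N = e^{t𝓛/N}` with `𝓛 = Σ_j h_j 𝓛_j` (eqs. (8), (B4), (B9)).
[cite: Campbell2019, eq. (8) and App. B eqs. (B4), (B9)] -/
noncomputable def slice (h : ι → ℝ) (L : ι → 𝔸) (t : ℝ) (N : ℕ) : 𝔸 :=
  exp ((t / N) • ∑ j, h j • L j)

omit [NormOneClass 𝔸] [CompleteSpace 𝔸] in
/-- Unfolding of `step`. [cite: Campbell2019, App. B eq. (B6)] -/
theorem step_eq (h : ι → ℝ) (L : ι → 𝔸) (τ : ℝ) :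
    step h L τ = ∑ j, (h j / ∑ i, h i) • exp (τ • L j) := rfl

omit [NormOneClass 𝔸] [CompleteSpace 𝔸] in
/-- Unfolding of `slice`. [cite: Campbell2019, App. B eq. (B9)] -/
theorem slice_eq (h : ι → ℝ) (L : ι → 𝔸) (t : ℝ) (N : ℕ) :
    slice h L t N = exp ((t / N) • ∑ j, h j • L j) := rfl

omit [NormOneClass 𝔸] [CompleteSpace 𝔸] in
/-- `‖𝓛‖ ≤ 2λ` from `‖𝓛_j‖ ≤ 2`, `h_j ≥ 0` ((B3) from (B4)–(B5)). [cite: Campbell2019, App. B eqs. (B3)–(B5)] -/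
theorem norm_liouvillian_le {h : ι → ℝ} (hh : ∀ j, 0 ≤ h j) {L : ι → 𝔸} (hL : ∀ j, ‖L j‖ ≤ 2) :
    ‖∑ j, h j • L j‖ ≤ 2 * ∑ j, h j := by
  calc ‖∑ j, h j • L j‖ ≤ ∑ j, ‖h j • L j‖ := norm_sum_le _ _
    _ ≤ ∑ j, h j * 2 := by
        refine sum_le_sum fun j _ => ?_
        rw [norm_smul, Real.norm_of_nonneg (hh j)]
        exact mul_le_mul_of_nonneg_left (hL j) (hh j)
    _ = 2 * ∑ j, h j := by rw [← sum_mul, mul_comm]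

/-- **(B10)/(B12), norm form.**  For weights `h_j ≥ 0` with `λ = Σ_j h_j > 0`, generators with the
printed normalisation `‖𝓛_j‖ ≤ 2`, `t ≥ 0`, `N ≥ 1` and the qDRIFT strength `τ = λt/N`:
`‖𝓤_N − 𝓔‖ ≤ (2λt/N)² · e^{2λt/N}` — the zeroth- and first-order terms cancel ("the first two terms
of `𝓔` and `𝓤_N` will match whenever `τ = λt/N`") and each second-order remainder is at most
`(x²/2)eˣ` at `x = 2λt/N` (B11), one from `𝓤_N` and a `p_j`-weighted one from `𝓔`.  The printed
`d(𝓤_N, 𝓔) ≤ (2λ²t²/N²) e^{2λt/N}` is half of this (their `d = ½‖·‖_◇`).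
[cite: Campbell2019, eq. (10) and App. B eqs. (B7)–(B12)] -/
theorem norm_slice_sub_step_le {h : ι → ℝ} (hh : ∀ j, 0 ≤ h j) (hlam : 0 < ∑ j, h j)
    {L : ι → 𝔸} (hL : ∀ j, ‖L j‖ ≤ 2) {t : ℝ} (ht : 0 ≤ t) {N : ℕ} (hN : 0 < N) :
    ‖slice h L t N - step h L (∑ j, h j * t / N)‖ ≤
      (2 * (∑ j, h j) * t / N) ^ 2 * Real.exp (2 * (∑ j, h j) * t / N) := by
  set lam : ℝ := ∑ j, h j with hlamdef
  set x : ℝ := 2 * lam * t / N with hx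
  set τ : ℝ := lam * t / N with hτ
  set a₀ : 𝔸 := (t / N) • ∑ j, h j • L j with ha₀
  have hNr : (0 : ℝ) < N := by exact_mod_cast hN
  have hlam0 : lam ≠ 0 := hlam.ne'
  have hτnn : 0 ≤ τ := by rw [hτ]; positivity
  -- the remainders `R(a) = exp a − 1 − a`
  set R : 𝔸 → 𝔸 := fun a => exp a - 1 - a with hR
  -- (B7)–(B9): `𝓤_N − 𝓔 = R(a₀) − Σ_j p_j • R(τ 𝓛_j)` (the first two orders cancel)
  have hp1 : ∑ j, h j / lam = 1 := by
    simp_rw [div_eq_mul_inv]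
    rw [← sum_mul, ← hlamdef, mul_inv_cancel₀ hlam0]
  have hkey : slice h L t N - step h L τ = R a₀ - ∑ j, (h j / lam) • R (τ • L j) := by
    have hE : step h L τ = ∑ j, (h j / lam) • R (τ • L j) + (1 + a₀) := by
      rw [step_eq, ← hlamdef]
      have hterm : ∀ j, (h j / lam) • exp (τ • L j) =
          (h j / lam) • R (τ • L j) + ((h j / lam) • (1 : 𝔸) + ((h j / lam) * τ) • L j) := by
        intro j
        rw [hR]
        simp only [smul_sub, mul_smul]
        abel
      rw [Finset.sum_congr rfl fun j _ => hterm j, sum_add_distrib, sum_add_distrib, ← sum_smul,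
        hp1, one_smul]
      congr 1
      congr 1
      rw [ha₀, smul_sum]
      refine sum_congr rfl fun j _ => ?_
      rw [smul_smul]
      congr 1
      rw [hτ]
      field_simp
    have hU : slice h L t N = R a₀ + (1 + a₀) := by
      rw [slice_eq, ← ha₀, hR]
      simp only
      abel
    rw [hE, hU]
    abel
  -- the two radii are at most `x`
  have ha₀x : ‖a₀‖ ≤ x := by
    rw [ha₀, norm_smul, Real.norm_of_nonneg (by positivity), hx]
    calc t / N * ‖∑ j, h j • L j‖ ≤ t / N * (2 * lam) :=
          mul_le_mul_of_nonneg_left (norm_liouvillian_le hh hL) (by positivity)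
      _ = 2 * lam * t / N := by ring
  have hτx : ∀ j, ‖τ • L j‖ ≤ x := fun j => by
    rw [norm_smul, Real.norm_of_nonneg hτnn, hx]
    calc τ * ‖L j‖ ≤ τ * 2 := mul_le_mul_of_nonneg_left (hL j) hτnn
      _ = 2 * lam * t / N := by rw [hτ]; ring
  -- assemble (B10)–(B12)
  have hRle : ∀ {a : 𝔸}, ‖a‖ ≤ x → ‖R a‖ ≤ x ^ 2 / 2 * Real.exp x :=
    fun hax => norm_exp_sub_one_sub_le_of_norm_le ℝ hax
  have hsum : ‖∑ j, (h j / lam) • R (τ • L j)‖ ≤ x ^ 2 / 2 * Real.exp x := by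
    calc ‖∑ j, (h j / lam) • R (τ • L j)‖ ≤ ∑ j, ‖(h j / lam) • R (τ • L j)‖ := norm_sum_le _ _
      _ ≤ ∑ j, (h j / lam) * (x ^ 2 / 2 * Real.exp x) := by
          refine sum_le_sum fun j _ => ?_
          rw [norm_smul, Real.norm_of_nonneg (div_nonneg (hh j) hlam.le)]
          exact mul_le_mul_of_nonneg_left (hRle (hτx j)) (div_nonneg (hh j) hlam.le)
      _ = x ^ 2 / 2 * Real.exp x := by rw [← sum_mul, hp1, one_mul]
  have hτarg : ∑ j, h j * t / N = τ := by
    rw [hτ, hlamdef, sum_mul]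
    simp_rw [div_eq_mul_inv]
    rw [← sum_mul]
  rw [hτarg, hkey]
  calc ‖R a₀ - ∑ j, (h j / lam) • R (τ • L j)‖
      ≤ ‖R a₀‖ + ‖∑ j, (h j / lam) • R (τ • L j)‖ := norm_sub_le _ _
    _ ≤ x ^ 2 / 2 * Real.exp x + x ^ 2 / 2 * Real.exp x := add_le_add (hRle ha₀x) hsum
    _ = x ^ 2 * Real.exp x := by ring

omit [NormOneClass 𝔸] [CompleteSpace 𝔸] in
/-- `‖𝓔‖ ≤ 1` when every `e^{τ𝓛_j}` is a contraction (a convex combination of contractions).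
[cite: Campbell2019, App. B (B13) ("the diamond distance is subadditive under composition")] -/
theorem norm_step_le_one {h : ι → ℝ} (hh : ∀ j, 0 ≤ h j) (hlam : 0 < ∑ j, h j) {L : ι → 𝔸}
    {τ : ℝ} (hE : ∀ j, ‖exp (τ • L j)‖ ≤ 1) : ‖step h L τ‖ ≤ 1 := by
  have hp1 : ∑ j, h j / ∑ i, h i = 1 := by
    simp_rw [div_eq_mul_inv]
    rw [← sum_mul, mul_inv_cancel₀ hlam.ne']
  calc ‖step h L τ‖ ≤ ∑ j, ‖(h j / ∑ i, h i) • exp (τ • L j)‖ := norm_sum_le _ _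
    _ ≤ ∑ j, h j / ∑ i, h i := by
        refine sum_le_sum fun j _ => ?_
        rw [norm_smul, Real.norm_of_nonneg (div_nonneg (hh j) hlam.le)]
        exact mul_le_of_le_one_right (div_nonneg (hh j) hlam.le) (hE j)
    _ = 1 := hp1

omit [NormOneClass 𝔸] in
/-- `𝓤_N^N = e^{t𝓛}` (`N ≥ 1`). [cite: Campbell2019, eq. (8) ("𝓤_N … is one Nth of the full dynamics")] -/
theorem slice_pow (h : ι → ℝ) (L : ι → 𝔸) (t : ℝ) {N : ℕ} (hN : 0 < N) :
    slice h L t N ^ N = exp (t • ∑ j, h j • L j) := by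
  letI : NormedAlgebra ℚ 𝔸 := NormedAlgebra.restrictScalars ℚ ℝ 𝔸
  rw [slice_eq, ← exp_nsmul, ← Nat.cast_smul_eq_nsmul ℝ, smul_smul]
  congr 2
  have : (N : ℝ) ≠ 0 := by exact_mod_cast hN.ne'
  field_simp

/-- **(B13), norm form — the qDRIFT error bound.**  Under the hypotheses of `norm_slice_sub_step_le`
and the contraction hypotheses `‖e^{τ𝓛_j}‖ ≤ 1`, `‖𝓤_N‖ ≤ 1` (unitary channels), the `N`-fold
qDRIFT channel approximates the exact evolution:
`‖e^{t𝓛} − 𝓔^N‖ ≤ N · (2λt/N)² e^{2λt/N} = (4λ²t²/N) e^{2λt/N}`,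
i.e. the printed `d_◇(𝓤, 𝓔^N) ≤ N d(𝓤_N, 𝓔) ≤ (2λ²t²/N) e^{2λt/N} ≈ 2λ²t²/N`, so that
`N = ⌈2λ²t²/ε⌉` random gates give diamond-distance precision `≈ ε` (eq. (11), Fig. 1 step 2).
[cite: Campbell2019, eqs. (10)–(11) and App. B eq. (B13)] -/
theorem norm_exp_sub_step_pow_le {h : ι → ℝ} (hh : ∀ j, 0 ≤ h j) (hlam : 0 < ∑ j, h j)
    {L : ι → 𝔸} (hL : ∀ j, ‖L j‖ ≤ 2) {t : ℝ} (ht : 0 ≤ t) {N : ℕ} (hN : 0 < N)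
    (hE : ∀ j, ‖exp ((∑ i, h i * t / N) • L j)‖ ≤ 1) (hU : ‖slice h L t N‖ ≤ 1) :
    ‖exp (t • ∑ j, h j • L j) - step h L (∑ j, h j * t / N) ^ N‖ ≤
      N * ((2 * (∑ j, h j) * t / N) ^ 2 * Real.exp (2 * (∑ j, h j) * t / N)) := by
  have hstep : ‖step h L (∑ i, h i * t / N)‖ ≤ 1 := norm_step_le_one hh hlam hE
  have hN1 : N - 1 + 1 = N := Nat.sub_add_cancel (Nat.succ_le_of_lt hN)
  have htel := norm_pow_sub_pow_le' (slice h L t N) (step h L (∑ i, h i * t / N)) hU hstep (N - 1)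
  rw [hN1, one_pow, mul_one] at htel
  have hcast : ((N - 1 : ℕ) : ℝ) + 1 = N := by exact_mod_cast hN1
  rw [hcast] at htel
  rw [← slice_pow h L t hN]
  exact htel.trans
    (mul_le_mul_of_nonneg_left (norm_slice_sub_step_le hh hlam hL ht hN) (Nat.cast_nonneg N))

end Channel

end QDrift

end Literature.Computability.QuantumAlgorithms
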